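import Literature.NumberTheory.EllipticCurves.EisensteinWeightOneConstantIntegral
import Mathlib.MeasureTheory.Integral.IntegralEqImproper
import HarnessLib

/-!
# The integral of the weight-one Eisenstein row kernel: `∫_ℝ k(w, s; t) dt = -i I₂(s) (Im w)^{-2s}`

Topic `Literature/NumberTheory/EllipticCurves`; namespace
`Literature.NumberTheory.EllipticCurves.ModularForms`. One definition with a body (`rowConstant`)
and theorems; no named fact.

For `Im w > 0` the row kernel `k(w, s; t) = (t+w)^{-1-s}(t+w̄)^{-s}` of
`EisensteinWeightOneRowKernel.lean` is integrable over `ℝ` for `Re s > 0`, and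

* `rowKernel_scale` — `k(w, s; (Im w) u - Re w) = (Im w)^{-1-2s} k(i, s; u)`, whence
  `integral_rowKernel_eq` — **`∫_ℝ k(w, s; t) dt = (Im w)^{-2s} c₀(s)`**, with the constant
  `c₀(s) = ∫_ℝ (u+i)^{-1-s}(u-i)^{-s} du` (`rowConstant`);
* `rowConstant_eq` — **`c₀(s) = -i I₂(s)`**, `I₂(s) = ∫_ℝ (1+u²)^{-1-s} du`
  (`EisensteinWeightOneConstantIntegral.lean`), for `Re s > 0`: with the mirror kernel
  `k₁(u) = (u+i)^{-s}(u-i)^{-1-s}` one has `d/du (1+u²)^{-s} = -s (k + k₁)`, so `∫ (k + k₁) = 0`,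
  while `k - k₁ = -2i (1+u²)^{-1-s}`.

Since `I₂` is holomorphic on `Re s > -1/2` with `I₂(0) = π`, the right-hand sides continue the
"constant term" of the full lattice row `∑_d k(w, s; d)` past `s = 0`, where it takes the value
`-iπ` — the constant `-πi` of `π cot(πw) = -πi - 2πi ∑ qᵐ` (Hecke 1927, §2; Schoeneberg VII §2).

## References

* E. Hecke, *Theorie der Eisensteinschen Reihen höherer Stufe…*, Abh. Math. Sem. Hamburg 5 (1927),
  §2.
* B. Schoeneberg, *Elliptic Modular Functions*, Springer (1974), Ch. VII §2.
-/

noncomputable section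

open Complex Real Set MeasureTheory Filter
open scoped Topology ComplexConjugate

namespace Literature.NumberTheory.EllipticCurves.ModularForms

/-- **The row constant** `c₀(s) = ∫_ℝ (u+i)^{-1-s}(u-i)^{-s} du = ∫_ℝ k(i, s; u) du`. [folklore] -/
def rowConstant (s : ℂ) : ℂ := ∫ u : ℝ, rowKernel I s u

/-! ### Scaling to `w = i` -/

/-- `(r z)ᵃ = rᵃ zᵃ` for real `r > 0` and `z ≠ 0` (a private copy of the lemma of
`EisensteinWeightOneLatticeLimit.lean`, to keep this file's imports light). [folklore] -/
private theorem ofReal_mul_cpow_of_pos' {r : ℝ} (hr : 0 < r) {z : ℂ} (hz : z ≠ 0) (a : ℂ) :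
    ((r : ℂ) * z) ^ a = (r : ℂ) ^ a * z ^ a := by
  have hr0 : (r : ℂ) ≠ 0 := by exact_mod_cast hr.ne'
  rw [cpow_def_of_ne_zero (mul_ne_zero hr0 hz), cpow_def_of_ne_zero hr0, cpow_def_of_ne_zero hz,
    Complex.log_ofReal_mul hr hz, add_mul, Complex.exp_add, Complex.ofReal_log hr.le]

section Scaling

variable {w : ℂ} (hw : 0 < w.im)
include hw

/-- **Scaling**: `k(w, s; (Im w) u - Re w) = (Im w)^{-1-2s} k(i, s; u)`. [folklore] -/
theorem rowKernel_scale (s : ℂ) (u : ℝ) :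
    rowKernel w s (w.im * u - w.re) = ((w.im : ℝ) : ℂ) ^ (-1 - 2 * s) * rowKernel I s u := by
  have hη0 : ((w.im : ℝ) : ℂ) ≠ 0 := by exact_mod_cast hw.ne'
  have hA : (u : ℂ) + I ≠ 0 := by
    intro h; have := congrArg Complex.im h; simp at this
  have hB : (u : ℂ) + conj I ≠ 0 := by
    intro h; have := congrArg Complex.im h; simp at this
  unfold rowKernel
  have e1 : (((w.im * u - w.re : ℝ)) : ℂ) + w = (w.im : ℂ) * ((u : ℂ) + I) := by
    apply Complex.ext <;> simp
  have e2 : (((w.im * u - w.re : ℝ)) : ℂ) + conj w = (w.im : ℂ) * ((u : ℂ) + conj I) := by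
    apply Complex.ext <;> simp
  rw [e1, e2, ofReal_mul_cpow_of_pos' hw hA, ofReal_mul_cpow_of_pos' hw hB,
    show (-1 - 2 * s) = (-1 - s) + (-s) by ring, cpow_add _ _ hη0]
  ring

/-- **`∫_ℝ k(w, s; t) dt = (Im w)^{-2s} c₀(s)`** (translation by `Re w` and dilation by `Im w`; an
identity of Lebesgue integrals, no integrability needed). [folklore] -/
theorem integral_rowKernel_eq (s : ℂ) :
    ∫ t : ℝ, rowKernel w s t = ((w.im : ℝ) : ℂ) ^ (-2 * s) * rowConstant s := by
  have hη : 0 < w.im := hw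
  have hη0 : ((w.im : ℝ) : ℂ) ≠ 0 := by exact_mod_cast hw.ne'
  set g : ℝ → ℂ := fun u ↦ rowKernel w s (w.im * u - w.re) with hg
  calc ∫ t : ℝ, rowKernel w s t = ∫ t : ℝ, g (w.im⁻¹ * (t + w.re)) := by
        refine integral_congr_ae (Eventually.of_forall fun t ↦ ?_)
        simp only [hg]
        congr 1
        field_simp
        ring
    _ = ∫ t : ℝ, g (w.im⁻¹ * t) := integral_add_right_eq_self (fun t ↦ g (w.im⁻¹ * t)) w.re
    _ = |w.im| • ∫ u : ℝ, g u := Measure.integral_comp_inv_mul_left g w.im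
    _ = ((w.im : ℝ) : ℂ) * (((w.im : ℝ) : ℂ) ^ (-1 - 2 * s) * rowConstant s) := by
        rw [abs_of_pos hη, Complex.real_smul]
        congr 1
        unfold rowConstant
        rw [← MeasureTheory.integral_const_mul]
        exact integral_congr_ae (Eventually.of_forall fun u ↦ rowKernel_scale hw s u)
    _ = ((w.im : ℝ) : ℂ) ^ (-2 * s) * rowConstant s := by
        rw [← mul_assoc, show (-2 * s) = 1 + (-1 - 2 * s) by ring, cpow_add _ _ hη0, cpow_one]

end Scaling

/-! ### `c₀(s) = -i I₂(s)` -/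

/-- `Im i = 1 > 0`. [folklore] -/
theorem I_im_pos : 0 < (I : ℂ).im := by simp

/-- The mirror kernel `k₁(u) = (u+i)^{-s}(u-i)^{-1-s}`; its norm is at most
`e^{2π|Im s|} (1+u²)^{-(1+2σ)/2}`, like that of `k`. [folklore] -/
theorem norm_mirror_le (s : ℂ) (u : ℝ) :
    ‖((u : ℂ) + I) ^ (-s) * ((u : ℂ) - I) ^ (-1 - s)‖ ≤
      Real.exp (2 * π * |s.im|) * (1 + u ^ 2) ^ (-(1 + 2 * s.re) / 2) := by
  have hA : (u : ℂ) + I ≠ 0 := by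
    intro h; have := congrArg Complex.im h; simp at this
  have hB : (u : ℂ) - I ≠ 0 := by
    intro h; have := congrArg Complex.im h; simp at this
  have hnA : ‖(u : ℂ) + I‖ = Real.sqrt (1 + u ^ 2) := by
    rw [Complex.norm_eq_sqrt_sq_add_sq]; simp [add_comm]
  have hnB : ‖(u : ℂ) - I‖ = Real.sqrt (1 + u ^ 2) := by
    rw [Complex.norm_eq_sqrt_sq_add_sq]; simp [add_comm]
  have hpos : 0 < 1 + u ^ 2 := by positivity
  have hsq : 0 < Real.sqrt (1 + u ^ 2) := Real.sqrt_pos.mpr hpos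
  have h1 := norm_cpow_le_rpow_mul_exp hA (-s)
  have h2 := norm_cpow_le_rpow_mul_exp hB (-1 - s)
  rw [hnA] at h1
  rw [hnB] at h2
  rw [norm_mul]
  have hexp1 : Real.exp (π * |(-s).im|) = Real.exp (π * |s.im|) := by simp
  have hexp2 : Real.exp (π * |(-1 - s).im|) = Real.exp (π * |s.im|) := by
    simp [abs_neg]
  rw [hexp1] at h1
  rw [hexp2] at h2
  calc ‖((u : ℂ) + I) ^ (-s)‖ * ‖((u : ℂ) - I) ^ (-1 - s)‖
      ≤ (Real.sqrt (1 + u ^ 2) ^ (-s).re * Real.exp (π * |s.im|)) *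
          (Real.sqrt (1 + u ^ 2) ^ (-1 - s).re * Real.exp (π * |s.im|)) :=
        mul_le_mul h1 h2 (norm_nonneg _) (by positivity)
    _ = Real.exp (2 * π * |s.im|) * (1 + u ^ 2) ^ (-(1 + 2 * s.re) / 2) := by
        have : Real.sqrt (1 + u ^ 2) ^ (-s).re * Real.sqrt (1 + u ^ 2) ^ (-1 - s).re =
            (1 + u ^ 2) ^ (-(1 + 2 * s.re) / 2) := by
          rw [← Real.rpow_add hsq, Real.sqrt_eq_rpow, ← Real.rpow_mul hpos.le]
          congr 1; simp; ring
        rw [show 2 * π * |s.im| = π * |s.im| + π * |s.im| by ring, Real.exp_add, ← this]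
        ring

/-- The kernel at `w = i` in the same form: `‖k(i, s; u)‖ ≤ e^{2π|Im s|}(1+u²)^{-(1+2σ)/2}`.
[folklore] -/
theorem norm_rowKernel_I_le (s : ℂ) (u : ℝ) :
    ‖rowKernel I s u‖ ≤ Real.exp (2 * π * |s.im|) * (1 + u ^ 2) ^ (-(1 + 2 * s.re) / 2) := by
  have h := norm_rowKernel_le I_im_pos s u
  have hn : ‖(u : ℂ) + I‖ = Real.sqrt (1 + u ^ 2) := by
    rw [Complex.norm_eq_sqrt_sq_add_sq]; simp [add_comm]
  rw [hn, Real.sqrt_eq_rpow, ← Real.rpow_mul (by positivity)] at h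
  convert h using 2
  congr 1; ring

/-- Continuity of the mirror kernel. [folklore] -/
theorem continuous_mirror (s : ℂ) :
    Continuous fun u : ℝ ↦ ((u : ℂ) + I) ^ (-s) * ((u : ℂ) - I) ^ (-1 - s) := by
  refine Continuous.mul ?_ ?_
  · refine Continuous.cpow (by fun_prop) continuous_const fun u ↦ ?_
    exact ofReal_add_mem_slitPlane I_im_pos u
  · refine Continuous.cpow (by fun_prop) continuous_const fun u ↦ ?_
    have := ofReal_add_conj_mem_slitPlane I_im_pos u
    simpa [sub_eq_add_neg] using this

/-- Integrability of `k(i, s; ·)` and of the mirror kernel for `Re s > 0`. [folklore] -/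
theorem integrable_rowKernel_I {s : ℂ} (hs : 0 < s.re) :
    Integrable fun u : ℝ ↦ rowKernel I s u := by
  have hc : Continuous fun u : ℝ ↦ rowKernel I s u :=
    continuous_iff_continuousAt.mpr fun u ↦ (hasDerivAt_rowKernel I_im_pos s u).continuousAt
  refine Integrable.mono' ((integrable_one_add_sq_rpow (a := 1 + 2 * s.re) (by linarith)).const_mul
    (Real.exp (2 * π * |s.im|))) hc.aestronglyMeasurable ?_
  exact Eventually.of_forall fun u ↦ norm_rowKernel_I_le s u

/-- Integrability of the mirror kernel for `Re s > 0`. [folklore] -/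
theorem integrable_mirror {s : ℂ} (hs : 0 < s.re) :
    Integrable fun u : ℝ ↦ ((u : ℂ) + I) ^ (-s) * ((u : ℂ) - I) ^ (-1 - s) := by
  refine Integrable.mono' ((integrable_one_add_sq_rpow (a := 1 + 2 * s.re) (by linarith)).const_mul
    (Real.exp (2 * π * |s.im|))) (continuous_mirror s).aestronglyMeasurable ?_
  exact Eventually.of_forall fun u ↦ norm_mirror_le s u

/-- `u + conj i = u - i`. [folklore] -/
theorem ofReal_add_conj_I (u : ℝ) : (u : ℂ) + conj I = (u : ℂ) - I := by
  rw [Complex.conj_I]; ring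

/-- **`d/du (u+i)^{-s}(u-i)^{-s} = -s (k(i,s;u) + k₁(u))`.** [folklore] -/
theorem hasDerivAt_prod_cpow_neg (s : ℂ) (u : ℝ) :
    HasDerivAt (fun u : ℝ ↦ ((u : ℂ) + I) ^ (-s) * ((u : ℂ) - I) ^ (-s))
      (-s * (rowKernel I s u + ((u : ℂ) + I) ^ (-s) * ((u : ℂ) - I) ^ (-1 - s))) u := by
  have hA : HasDerivAt (fun z : ℂ ↦ (z + I) ^ (-s)) ((-s) * ((u : ℂ) + I) ^ (-s - 1) * 1) (u : ℂ) :=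
    ((hasDerivAt_id (u : ℂ)).add_const I).cpow_const (ofReal_add_mem_slitPlane I_im_pos u)
  have hBm : (u : ℂ) - I ∈ slitPlane := by
    have := ofReal_add_conj_mem_slitPlane I_im_pos u
    rwa [ofReal_add_conj_I] at this
  have hB : HasDerivAt (fun z : ℂ ↦ (z - I) ^ (-s)) ((-s) * ((u : ℂ) - I) ^ (-s - 1) * 1) (u : ℂ) :=
    ((hasDerivAt_id (u : ℂ)).sub_const I).cpow_const hBm
  have hAB := (hA.mul hB).comp_ofReal
  refine hAB.congr_deriv ?_
  unfold rowKernel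
  rw [ofReal_add_conj_I, show (-s - 1) = (-1 - s) by ring]
  ring

/-- The product `(u+i)^{-s}(u-i)^{-s}` tends to `0` as `u → ±∞` (`Re s > 0`). [folklore] -/
theorem norm_prod_cpow_neg_le (s : ℂ) (u : ℝ) :
    ‖((u : ℂ) + I) ^ (-s) * ((u : ℂ) - I) ^ (-s)‖ ≤
      Real.exp (2 * π * |s.im|) * (1 + u ^ 2) ^ (-s.re) := by
  have hA : (u : ℂ) + I ≠ 0 := by
    intro h; have := congrArg Complex.im h; simp at this
  have hB : (u : ℂ) - I ≠ 0 := by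
    intro h; have := congrArg Complex.im h; simp at this
  have hnA : ‖(u : ℂ) + I‖ = Real.sqrt (1 + u ^ 2) := by
    rw [Complex.norm_eq_sqrt_sq_add_sq]; simp [add_comm]
  have hnB : ‖(u : ℂ) - I‖ = Real.sqrt (1 + u ^ 2) := by
    rw [Complex.norm_eq_sqrt_sq_add_sq]; simp [add_comm]
  have hpos : 0 < 1 + u ^ 2 := by positivity
  have hsq : 0 < Real.sqrt (1 + u ^ 2) := Real.sqrt_pos.mpr hpos
  have h1 := norm_cpow_le_rpow_mul_exp hA (-s)
  have h2 := norm_cpow_le_rpow_mul_exp hB (-s)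
  rw [hnA] at h1
  rw [hnB] at h2
  have hexp : Real.exp (π * |(-s).im|) = Real.exp (π * |s.im|) := by simp
  rw [hexp] at h1 h2
  rw [norm_mul]
  calc ‖((u : ℂ) + I) ^ (-s)‖ * ‖((u : ℂ) - I) ^ (-s)‖
      ≤ (Real.sqrt (1 + u ^ 2) ^ (-s).re * Real.exp (π * |s.im|)) *
          (Real.sqrt (1 + u ^ 2) ^ (-s).re * Real.exp (π * |s.im|)) :=
        mul_le_mul h1 h2 (norm_nonneg _) (by positivity)
    _ = Real.exp (2 * π * |s.im|) * (1 + u ^ 2) ^ (-s.re) := by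
        have : Real.sqrt (1 + u ^ 2) ^ (-s).re * Real.sqrt (1 + u ^ 2) ^ (-s).re =
            (1 + u ^ 2) ^ (-s.re) := by
          rw [← Real.rpow_add hsq, Real.sqrt_eq_rpow, ← Real.rpow_mul hpos.le]
          congr 1; simp; ring
        rw [show 2 * π * |s.im| = π * |s.im| + π * |s.im| by ring, Real.exp_add, ← this]
        ring

/-- `(1 + u²)^{-σ} → 0` as `u → ±∞` (`σ > 0`), along `atTop` and `atBot`. [folklore] -/
theorem tendsto_one_add_sq_rpow_neg {σ : ℝ} (hσ : 0 < σ) :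
    Tendsto (fun u : ℝ ↦ (1 + u ^ 2) ^ (-σ)) atTop (𝓝 0) ∧
      Tendsto (fun u : ℝ ↦ (1 + u ^ 2) ^ (-σ)) atBot (𝓝 0) := by
  have h1 : Tendsto (fun u : ℝ ↦ 1 + u ^ 2) atTop atTop :=
    tendsto_atTop_add_const_left _ 1 (tendsto_pow_atTop two_ne_zero)
  have h2 : Tendsto (fun u : ℝ ↦ 1 + u ^ 2) atBot atTop := by
    have : (fun u : ℝ ↦ 1 + u ^ 2) = (fun u : ℝ ↦ 1 + u ^ 2) ∘ Neg.neg := by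
      funext u; simp
    rw [this]
    exact h1.comp tendsto_neg_atBot_atTop
  exact ⟨(tendsto_rpow_neg_atTop hσ).comp h1, (tendsto_rpow_neg_atTop hσ).comp h2⟩

/-- **`∫_ℝ (k(i, s; u) + k₁(u)) du = 0`** for `Re s > 0` (the integrand is
`-(1/s) d/du (u+i)^{-s}(u-i)^{-s}`, which vanishes at `±∞`). [folklore] -/
theorem integral_rowKernel_add_mirror {s : ℂ} (hs : 0 < s.re) :
    ∫ u : ℝ, (rowKernel I s u + ((u : ℂ) + I) ^ (-s) * ((u : ℂ) - I) ^ (-1 - s)) = 0 := by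
  have hs0 : s ≠ 0 := by rintro rfl; simp at hs
  have hint : Integrable fun u : ℝ ↦
      -s * (rowKernel I s u + ((u : ℂ) + I) ^ (-s) * ((u : ℂ) - I) ^ (-1 - s)) :=
    ((integrable_rowKernel_I hs).add (integrable_mirror hs)).const_mul (-s)
  -- the primitive tends to `0` at both ends
  obtain ⟨htop, hbot⟩ := tendsto_one_add_sq_rpow_neg hs
  have hlim : ∀ {l : Filter ℝ}, Tendsto (fun u : ℝ ↦ (1 + u ^ 2) ^ (-s.re)) l (𝓝 0) →
      Tendsto (fun u : ℝ ↦ ((u : ℂ) + I) ^ (-s) * ((u : ℂ) - I) ^ (-s)) l (𝓝 0) := by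
    intro l hl
    rw [tendsto_zero_iff_norm_tendsto_zero]
    refine squeeze_zero (fun u ↦ norm_nonneg _) (fun u ↦ norm_prod_cpow_neg_le s u) ?_
    simpa using hl.const_mul (Real.exp (2 * π * |s.im|))
  have h := integral_of_hasDerivAt_of_tendsto (fun u ↦ hasDerivAt_prod_cpow_neg s u) hint
    (hlim hbot) (hlim htop)
  rw [sub_zero, MeasureTheory.integral_const_mul, mul_eq_zero] at h
  rcases h with h | h
  · exact absurd (neg_eq_zero.mp h) hs0
  · exact h

/-- **Pointwise: `k(i, s; u) - k₁(u) = -2i (1 + u²)^{-1-s}`.** [folklore] -/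
theorem rowKernel_sub_mirror (s : ℂ) (u : ℝ) :
    rowKernel I s u - ((u : ℂ) + I) ^ (-s) * ((u : ℂ) - I) ^ (-1 - s) =
      -2 * I * (((1 + u ^ 2 : ℝ)) : ℂ) ^ (-1 - s) := by
  have hA : (u : ℂ) + I ≠ 0 := by
    intro h; have := congrArg Complex.im h; simp at this
  have hB : (u : ℂ) - I ≠ 0 := by
    intro h; have := congrArg Complex.im h; simp at this
  -- the common factor `(u+i)^{-1-s}(u-i)^{-1-s} = (1+u²)^{-1-s}`
  have hP : ((u : ℂ) + I) ^ (-1 - s) * ((u : ℂ) - I) ^ (-1 - s) =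
      (((1 + u ^ 2 : ℝ)) : ℂ) ^ (-1 - s) := by
    have h := cpow_neg_mul_conj_cpow_neg (z := (u : ℂ) + I) (by simp) (1 + s)
    rw [map_add, Complex.conj_ofReal, Complex.conj_I, ← sub_eq_add_neg] at h
    have hn : ‖(u : ℂ) + I‖ ^ 2 = 1 + u ^ 2 := by
      rw [Complex.sq_norm, Complex.normSq_apply]; simp; ring
    rw [hn, show (-(1 + s)) = (-1 - s) by ring] at h
    exact h
  have eA : ((u : ℂ) + I) ^ (-s) = ((u : ℂ) + I) ^ (-1 - s) * ((u : ℂ) + I) := by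
    rw [show (-s) = (-1 - s) + 1 by ring, cpow_add _ _ hA, cpow_one]
  have eB : ((u : ℂ) - I) ^ (-s) = ((u : ℂ) - I) ^ (-1 - s) * ((u : ℂ) - I) := by
    rw [show (-s) = (-1 - s) + 1 by ring, cpow_add _ _ hB, cpow_one]
  unfold rowKernel
  rw [ofReal_add_conj_I, eA, eB, ← hP]
  ring

/-- **`c₀(s) = -i I₂(s)` for `Re s > 0`.** [folklore] -/
theorem rowConstant_eq {s : ℂ} (hs : 0 < s.re) : rowConstant s = -I * constIntegral s := by
  have hk := integrable_rowKernel_I hs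
  have hm := integrable_mirror hs
  have h1 : rowConstant s + ∫ u : ℝ, ((u : ℂ) + I) ^ (-s) * ((u : ℂ) - I) ^ (-1 - s) = 0 := by
    rw [rowConstant, ← integral_add hk hm]
    exact integral_rowKernel_add_mirror hs
  have h2 : rowConstant s - ∫ u : ℝ, ((u : ℂ) + I) ^ (-s) * ((u : ℂ) - I) ^ (-1 - s) =
      -2 * I * constIntegral s := by
    rw [rowConstant, ← integral_sub hk hm, constIntegral, ← MeasureTheory.integral_const_mul]
    exact integral_congr_ae (Eventually.of_forall fun u ↦ rowKernel_sub_mirror s u)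
  linear_combination (h1 + h2) / 2

/-- Hence **`∫_ℝ k(w, s; t) dt = -i I₂(s) (Im w)^{-2s}`** for `Re s > 0`. [folklore] -/
theorem integral_rowKernel_eq_constIntegral {w : ℂ} (hw : 0 < w.im) {s : ℂ} (hs : 0 < s.re) :
    ∫ t : ℝ, rowKernel w s t = -I * constIntegral s * ((w.im : ℝ) : ℂ) ^ (-2 * s) := by
  rw [integral_rowKernel_eq hw, rowConstant_eq hs]
  ring

end Literature.NumberTheory.EllipticCurves.ModularForms
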